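import Summits.KontsevichZagierPeriods.KontsevichZagierPeriods.Theorems.RootDecompQuadraticDescentZ7ComposeP2

/-! # `RootDecompQuadraticDescentZ7ComposeP3` — part 3/5 of the mechanical ≤400-line split of `Z7Compose.lean` (sha256 65b37838cbe1d1d8…)
Source: decomp-kz lens-6 g11 `Z7Compose.lean` v2 (HOME/decomp-kz-lens-6/g11/, sha256 65b37838…; critic g5-39/g5-47/g5-52 CLEARED, writer A2.4: land Z7Compose v2 + RayAffineRational --supports 28994): K26a / Zagier's Z₇ decided inside the ℚ-rational weight-2 box of crux 28994 — z7_pair: ∃ r r' ℚ-rational with the same integrand 1/(2v(1+τ²)), [r] ≡ 6[T(u)]+6[T(ū²)]+2[T(u³)]+7[T(ζ₇³)], [r'] ≡ 7[T(ζ₇)]+7[T(ζ₇²)], r.value = r'.value, [r] − [r'] ∈ KZ.relations, over five binders = verbatim tree-theorem types; landed by census-1 g9.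
Split by census-1 g9 `gen/splitlean.py`: scopes re-opened with their `open`/`variable`/`set_option` context; mathematics and declaration order unchanged. -/

noncomputable section
open scoped BigOperators ComplexConjugate
open Set
open Literature.NumberTheory.Transcendental
namespace Summit.KontsevichZagierPeriods.RootDecompQuadraticDescent.Z7Compose
section Pair
open MeasureTheory MvPolynomial
open Literature.ModelTheory.ExponentialFields (IsSemialgebraic isSemialgebraic_setOf_eval_lt)

/-- **Multiplicity by rule (1b):** `k·[P] ≡ [P.domain, k·g]`. [cite: KontsevichZagier2001, §1.2 rule (1)] -/
theorem scale_rep (P : KZ.IntegralRep 2) (hP : EqOn P.integrand gInt P.domain)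
    (hne : ∀ w ∈ P.domain, w 1 ≠ 0) (k : ℕ) (hk : 1 ≤ k) :
    ∃ Q : KZ.IntegralRep 2, Q.domain = P.domain ∧
      EqOn Q.integrand (fun w => (k : ℝ) * gInt w) Q.domain ∧
      (k : ℤ) • KZ.of P - KZ.of Q ∈ KZ.relations := by
  induction k with
  | zero => exact absurd hk (by norm_num)
  | succ j ih =>
    rcases Nat.eq_zero_or_pos j with rfl | hj
    · refine ⟨P, rfl, fun w hw => ?_, ?_⟩
      · rw [hP hw]
        simp
      · simp
    · obtain ⟨Pj, hPjd, hPji, hrel⟩ := ih hj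
      obtain ⟨Q, hQd, hQi⟩ := exists_rep_const_mul P hP hne (j + 1)
      refine ⟨Q, hQd, fun w _ => by rw [hQi], ?_⟩
      have hadd : KZ.of Q - KZ.of Pj - KZ.of P ∈ KZ.relations := by
        refine KZ.integrandAddRel_subset_relations ⟨2, Q, Pj, P, hPjd.trans hQd.symm, hQd.symm, ?_, rfl⟩
        intro w hw
        have hwP : w ∈ P.domain := hQd ▸ hw
        have hwPj : w ∈ Pj.domain := hPjd.symm ▸ hwP
        rw [hQi, Pi.add_apply, hPji hwPj, hP hwP]
        push_cast
        ring
      have e : ((j + 1 : ℕ) : ℤ) • KZ.of P - KZ.of Q =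
          ((j : ℤ) • KZ.of P - KZ.of Pj) - (KZ.of Q - KZ.of Pj - KZ.of P) := by
        push_cast
        rw [add_smul, one_smul]
        abel
      rw [e]
      exact KZ.relations.sub_mem hrel hadd

/-! ### The power maps `(τ, v) ↦ (τ, v^k)` -/

/-- The power map is a `ℚ`-semialgebraic map (polynomial coordinates). [cite: BochnakCosteRoy1998, §2.2] -/
theorem powMap_isSemialgebraicMapOn (k : ℕ) {σ : Set (Fin 2 → ℝ)} (hσ : IsSemialgebraic ℚ σ) :
    IsSemialgebraicMapOn ℚ σ (fun w => (![w 0, w 1 ^ k] : Fin 2 → ℝ)) := by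
  have s0 : IsSemialgebraicFunOn ℚ σ (fun w => w 0) :=
    (isSemialgebraicFunOn_aeval hσ (X 0)).congr fun w _ => by simp
  have s1 : IsSemialgebraicFunOn ℚ σ (fun w => w 1 ^ k) :=
    (isSemialgebraicFunOn_aeval hσ (X 1 ^ k)).congr fun w _ => by simp
  refine IsSemialgebraicMapOn.of_forall hσ fun j => ?_
  fin_cases j
  · exact s0.congr fun w _ => by simp
  · exact s1.congr fun w _ => by simp

/-- The power map is injective on `{v > 0}`. [folklore] -/
theorem powMap_injOn (k : ℕ) (hk : 1 ≤ k) {σ : Set (Fin 2 → ℝ)} (hσ : ∀ w ∈ σ, 0 < w 1) :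
    InjOn (fun w => (![w 0, w 1 ^ k] : Fin 2 → ℝ)) σ := by
  intro w hw w' hw' h
  have h0 := congrFun h 0
  have h1 := congrFun h 1
  simp only [Matrix.cons_val_zero, Matrix.cons_val_one] at h0 h1
  have h1' : w 1 = w' 1 := (pow_left_inj₀ (hσ w hw).le (hσ w' hw').le (by omega)).1 h1
  funext i
  fin_cases i
  · exact h0
  · exact h1'

/-- The derivative `diag(1, k v^{k−1})` of the power map. [folklore] -/
def powDeriv (k : ℕ) (x : Fin 2 → ℝ) : (Fin 2 → ℝ) →L[ℝ] (Fin 2 → ℝ) :=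
  LinearMap.toContinuousLinearMap (Matrix.toLin' !![1, 0; 0, (k : ℝ) * x 1 ^ (k - 1)])

/-- The power map has derivative `powDeriv k x`, of determinant `k v^{k−1}`. [folklore] -/
theorem powMap_hasFDerivAt (k : ℕ) (x : Fin 2 → ℝ) :
    HasFDerivAt (fun w => (![w 0, w 1 ^ k] : Fin 2 → ℝ)) (powDeriv k x) x ∧
      (powDeriv k x).det = (k : ℝ) * x 1 ^ (k - 1) := by
  constructor
  · have e0 : HasFDerivAt (fun y : Fin 2 → ℝ => y 0) (ContinuousLinearMap.proj 0) x :=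
      hasFDerivAt_apply (𝕜 := ℝ) 0 x
    have e1 : HasFDerivAt (fun y : Fin 2 → ℝ => y 1) (ContinuousLinearMap.proj 1) x :=
      hasFDerivAt_apply (𝕜 := ℝ) 1 x
    have h0 : HasFDerivAt (fun y => (![y 0, y 1 ^ k] : Fin 2 → ℝ) 0)
        ((ContinuousLinearMap.proj 0).comp (powDeriv k x)) x := by
      have hf : (fun y => (![y 0, y 1 ^ k] : Fin 2 → ℝ) 0) = fun y : Fin 2 → ℝ => y 0 := by
        funext y
        simp
      rw [hf]
      refine e0.congr_fderiv (ContinuousLinearMap.ext fun u => ?_)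
      simp [powDeriv, Matrix.toLin'_apply, dotProduct, Fin.sum_univ_two]
    have h1 : HasFDerivAt (fun y => (![y 0, y 1 ^ k] : Fin 2 → ℝ) 1)
        ((ContinuousLinearMap.proj 1).comp (powDeriv k x)) x := by
      have hf : (fun y => (![y 0, y 1 ^ k] : Fin 2 → ℝ) 1) =
          (fun t : ℝ => t ^ k) ∘ fun y : Fin 2 → ℝ => y 1 := by
        funext y
        simp
      rw [hf]
      refine ((hasDerivAt_pow k (x 1)).hasFDerivAt.comp x e1).congr_fderiv
        (ContinuousLinearMap.ext fun u => ?_)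
      first
        | (simp [powDeriv, Matrix.toLin'_apply, dotProduct, Fin.sum_univ_two]; done)
        | (simp [powDeriv, Matrix.toLin'_apply, dotProduct, Fin.sum_univ_two]; ring)
    refine hasFDerivAt_pi'' fun i => ?_
    fin_cases i
    exacts [h0, h1]
  · rw [powDeriv, LinearMap.det_toContinuousLinearMap, LinearMap.det_toLin', Matrix.det_fin_two]
    simp

/-- **The power move (rule (2) along `v ↦ v^k`):** `[D, k·g] ≡ [Φ_k(D), g]`, because
`g(τ, v^k)·k v^{k−1} = k·g(τ, v)`. [cite: KontsevichZagier2001, §1.2 rule (2)] -/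
theorem power_rep (k : ℕ) (hk : 1 ≤ k) (P : KZ.IntegralRep 2)
    (hP : EqOn P.integrand (fun w => (k : ℝ) * gInt w) P.domain) (hpos : ∀ w ∈ P.domain, 0 < w 1) :
    ∃ Q : KZ.IntegralRep 2, Q.domain = (fun w => (![w 0, w 1 ^ k] : Fin 2 → ℝ)) '' P.domain ∧
      EqOn Q.integrand gInt Q.domain ∧ KZ.of P - KZ.of Q ∈ KZ.relations := by
  obtain ⟨Φ, hΦ⟩ : ∃ Φ : (Fin 2 → ℝ) → (Fin 2 → ℝ), Φ = fun w => ![w 0, w 1 ^ k] := ⟨_, rfl⟩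
  have hΦsa : IsSemialgebraicMapOn ℚ P.domain Φ :=
    hΦ ▸ powMap_isSemialgebraicMapOn k P.isSemialgebraic_domain
  have hinj : InjOn Φ P.domain := hΦ ▸ powMap_injOn k hk hpos
  have hderiv : ∀ x ∈ P.domain, HasFDerivWithinAt Φ (powDeriv k x) P.domain x :=
    fun x _ => (hΦ ▸ (powMap_hasFDerivAt k x).1).hasFDerivWithinAt
  have hjac : ∀ x ∈ P.domain, P.integrand x = gInt (Φ x) * |(powDeriv k x).det| := by
    intro x hx
    have hu : 0 < x 1 := hpos x hx
    rw [hP hx, (powMap_hasFDerivAt k x).2, abs_of_nonneg (by positivity), hΦ]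
    simp only [gInt, Matrix.cons_val_zero, Matrix.cons_val_one]
    obtain ⟨m, rfl⟩ : ∃ m, k = m + 1 := ⟨k - 1, by omega⟩
    simp only [Nat.add_sub_cancel]
    have hu' : x 1 ≠ 0 := hu.ne'
    have hum : x 1 ^ m ≠ 0 := pow_ne_zero m hu'
    have h2 : (1 : ℝ) + x 0 ^ 2 ≠ 0 := by positivity
    push_cast
    field_simp
    ring
  have hmeas : MeasurableSet P.domain := KZ.IntegralRep.measurableSet_domain_holds P
  have hT : IsSemialgebraic ℚ (Φ '' P.domain) :=
    IsSemialgebraicMapOn.isSemialgebraic_image_holds hΦsa subset_rfl P.isSemialgebraic_domain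
  have hpos' : ∀ w ∈ Φ '' P.domain, w 1 ≠ 0 := by
    rintro _ ⟨w, hw, rfl⟩
    rw [hΦ]
    simp only [Matrix.cons_val_one]
    exact (pow_pos (hpos w hw) k).ne'
  have hF := gInt_isSemialgebraicFunOn hT hpos'
  have hI : IntegrableOn gInt (Φ '' P.domain) := by
    rw [integrableOn_image_iff_integrableOn_abs_det_fderiv_smul volume hmeas hderiv hinj]
    refine P.integrableOn.congr_fun (fun x hx => ?_) hmeas
    rw [hjac x hx, smul_eq_mul, mul_comm]
  refine ⟨⟨Φ '' P.domain, gInt, hT, hF, hI⟩, by simp only [hΦ], fun _ _ => rfl, ?_⟩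
  exact KZ.changeOfVariablesRel_subset_relations
    ⟨2, P, _, Φ, powDeriv k, hΦsa, hderiv, hinj, rfl, fun x hx => hjac x hx, rfl⟩

/-! ### The inversion `(τ, v) ↦ (τ, 1/v)` -/

/-- The inversion is a `ℚ`-semialgebraic map on `σ ⊆ {v ≠ 0}`. [cite: BochnakCosteRoy1998, §2.2] -/
theorem invMap_isSemialgebraicMapOn {σ : Set (Fin 2 → ℝ)} (hσ : IsSemialgebraic ℚ σ)
    (hne : ∀ w ∈ σ, w 1 ≠ 0) :
    IsSemialgebraicMapOn ℚ σ (fun w => (![w 0, (w 1)⁻¹] : Fin 2 → ℝ)) := by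
  have s0 : IsSemialgebraicFunOn ℚ σ (fun w => w 0) :=
    (isSemialgebraicFunOn_aeval hσ (X 0)).congr fun w _ => by simp
  have s1 : IsSemialgebraicFunOn ℚ σ (fun w => w 1) :=
    (isSemialgebraicFunOn_aeval hσ (X 1)).congr fun w _ => by simp
  have s1i : IsSemialgebraicFunOn ℚ σ (fun w => (w 1)⁻¹) := s1.inv hne
  refine IsSemialgebraicMapOn.of_forall hσ fun j => ?_
  fin_cases j
  · exact s0.congr fun w _ => by simp
  · exact s1i.congr fun w _ => by simp

/-- The inversion is injective. [folklore] -/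
theorem invMap_injOn (σ : Set (Fin 2 → ℝ)) : InjOn (fun w => (![w 0, (w 1)⁻¹] : Fin 2 → ℝ)) σ := by
  intro w _ w' _ h
  have h0 := congrFun h 0
  have h1 := congrFun h 1
  simp only [Matrix.cons_val_zero, Matrix.cons_val_one] at h0 h1
  funext i
  fin_cases i
  · exact h0
  · exact inv_inj.1 h1

/-- The derivative `diag(1, −1/v²)` of the inversion. [folklore] -/
def invDeriv (x : Fin 2 → ℝ) : (Fin 2 → ℝ) →L[ℝ] (Fin 2 → ℝ) :=
  LinearMap.toContinuousLinearMap (Matrix.toLin' !![1, 0; 0, -(x 1 ^ 2)⁻¹])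

/-- The inversion has derivative `invDeriv x` at `x` with `x 1 ≠ 0`, of determinant `−1/v²`. [folklore] -/
theorem invMap_hasFDerivAt (x : Fin 2 → ℝ) (hx : x 1 ≠ 0) :
    HasFDerivAt (fun w => (![w 0, (w 1)⁻¹] : Fin 2 → ℝ)) (invDeriv x) x ∧
      (invDeriv x).det = -(x 1 ^ 2)⁻¹ := by
  constructor
  · have e0 : HasFDerivAt (fun y : Fin 2 → ℝ => y 0) (ContinuousLinearMap.proj 0) x :=
      hasFDerivAt_apply (𝕜 := ℝ) 0 x
    have e1 : HasFDerivAt (fun y : Fin 2 → ℝ => y 1) (ContinuousLinearMap.proj 1) x :=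
      hasFDerivAt_apply (𝕜 := ℝ) 1 x
    have h0 : HasFDerivAt (fun y => (![y 0, (y 1)⁻¹] : Fin 2 → ℝ) 0)
        ((ContinuousLinearMap.proj 0).comp (invDeriv x)) x := by
      have hf : (fun y => (![y 0, (y 1)⁻¹] : Fin 2 → ℝ) 0) = fun y : Fin 2 → ℝ => y 0 := by
        funext y
        simp
      rw [hf]
      refine e0.congr_fderiv (ContinuousLinearMap.ext fun u => ?_)
      simp [invDeriv, Matrix.toLin'_apply, dotProduct, Fin.sum_univ_two]
    have h1 : HasFDerivAt (fun y => (![y 0, (y 1)⁻¹] : Fin 2 → ℝ) 1)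
        ((ContinuousLinearMap.proj 1).comp (invDeriv x)) x := by
      have hf : (fun y => (![y 0, (y 1)⁻¹] : Fin 2 → ℝ) 1) =
          (fun t : ℝ => t⁻¹) ∘ fun y : Fin 2 → ℝ => y 1 := by
        funext y
        simp
      rw [hf]
      refine ((hasDerivAt_inv hx).hasFDerivAt.comp x e1).congr_fderiv
        (ContinuousLinearMap.ext fun u => ?_)
      first
        | (simp [invDeriv, Matrix.toLin'_apply, dotProduct, Fin.sum_univ_two]; done)
        | (simp [invDeriv, Matrix.toLin'_apply, dotProduct, Fin.sum_univ_two]; ring)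
    refine hasFDerivAt_pi'' fun i => ?_
    fin_cases i
    exacts [h0, h1]
  · rw [invDeriv, LinearMap.det_toContinuousLinearMap, LinearMap.det_toLin', Matrix.det_fin_two]
    simp

/-- **The inversion move (rule (2) along `v ↦ 1/v`):** `[D, g] ≡ [Ψ(D), g]`, because `g(τ, 1/v)/v² = g(τ, v)`.
[cite: KontsevichZagier2001, §1.2 rule (2)] -/
theorem invert_rep (P : KZ.IntegralRep 2) (hP : EqOn P.integrand gInt P.domain)
    (hpos : ∀ w ∈ P.domain, 0 < w 1) :
    ∃ Q : KZ.IntegralRep 2, Q.domain = (fun w => (![w 0, (w 1)⁻¹] : Fin 2 → ℝ)) '' P.domain ∧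
      EqOn Q.integrand gInt Q.domain ∧ KZ.of P - KZ.of Q ∈ KZ.relations := by
  obtain ⟨Ψ, hΨ⟩ : ∃ Ψ : (Fin 2 → ℝ) → (Fin 2 → ℝ), Ψ = fun w => ![w 0, (w 1)⁻¹] := ⟨_, rfl⟩
  have hne : ∀ w ∈ P.domain, w 1 ≠ 0 := fun w hw => (hpos w hw).ne'
  have hΨsa : IsSemialgebraicMapOn ℚ P.domain Ψ :=
    hΨ ▸ invMap_isSemialgebraicMapOn P.isSemialgebraic_domain hne
  have hinj : InjOn Ψ P.domain := hΨ ▸ invMap_injOn P.domain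
  have hderiv : ∀ x ∈ P.domain, HasFDerivWithinAt Ψ (invDeriv x) P.domain x :=
    fun x hx => (hΨ ▸ (invMap_hasFDerivAt x (hne x hx)).1).hasFDerivWithinAt
  have hjac : ∀ x ∈ P.domain, P.integrand x = gInt (Ψ x) * |(invDeriv x).det| := by
    intro x hx
    have hu : 0 < x 1 := hpos x hx
    have hu2 : 0 < (x 1 ^ 2)⁻¹ := by positivity
    rw [hP hx, (invMap_hasFDerivAt x (hne x hx)).2, abs_neg, abs_of_pos hu2, hΨ]
    simp only [gInt, Matrix.cons_val_zero, Matrix.cons_val_one]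
    have hu' : x 1 ≠ 0 := hu.ne'
    have h2 : (1 : ℝ) + x 0 ^ 2 ≠ 0 := by positivity
    field_simp
  have hmeas : MeasurableSet P.domain := KZ.IntegralRep.measurableSet_domain_holds P
  have hT : IsSemialgebraic ℚ (Ψ '' P.domain) :=
    IsSemialgebraicMapOn.isSemialgebraic_image_holds hΨsa subset_rfl P.isSemialgebraic_domain
  have hpos' : ∀ w ∈ Ψ '' P.domain, w 1 ≠ 0 := by
    rintro _ ⟨w, hw, rfl⟩
    rw [hΨ]
    simp only [Matrix.cons_val_one]
    exact (inv_pos.2 (hpos w hw)).ne'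
  have hF := gInt_isSemialgebraicFunOn hT hpos'
  have hI : IntegrableOn gInt (Ψ '' P.domain) := by
    rw [integrableOn_image_iff_integrableOn_abs_det_fderiv_smul volume hmeas hderiv hinj]
    refine P.integrableOn.congr_fun (fun x hx => ?_) hmeas
    rw [hjac x hx, smul_eq_mul, mul_comm]
  refine ⟨⟨Ψ '' P.domain, gInt, hT, hF, hI⟩, by simp only [hΨ], fun _ _ => rfl, ?_⟩
  exact KZ.changeOfVariablesRel_subset_relations
    ⟨2, P, _, Ψ, invDeriv, hΨsa, hderiv, hinj, rfl, fun x hx => hjac x hx, rfl⟩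

/-! ### The two slots `v < 1` and `v > 1` -/

/-- **Slot A:** from a piece `[D, g]` with `D ⊆ {C(τ)} × (0,1)`, a piece `[D', g]` with `D' ⊆ {C(τ)} × (0,1)` and
`k[D, g] ≡ [D', g]`. [cite: KontsevichZagier2001, §1.2] -/
theorem slotA (C : ℝ → Prop) (R : KZ.IntegralRep 2)
    (hRd : ∀ w ∈ R.domain, C (w 0) ∧ 0 < w 1 ∧ w 1 < 1) (hRi : EqOn R.integrand gInt R.domain)
    (k : ℕ) (hk : 1 ≤ k) :
    ∃ P : KZ.IntegralRep 2, (∀ w ∈ P.domain, C (w 0) ∧ 0 < w 1 ∧ w 1 < 1) ∧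
      EqOn P.integrand gInt P.domain ∧ (k : ℤ) • KZ.of R - KZ.of P ∈ KZ.relations := by
  obtain ⟨Q, hQd, hQi, hQ⟩ := scale_rep R hRi (fun w hw => (hRd w hw).2.1.ne') k hk
  obtain ⟨P, hPd, hPi, hP⟩ := power_rep k hk Q hQi (fun w hw => (hRd w (hQd ▸ hw)).2.1)
  refine ⟨P, fun w hw => ?_, hPi, ?_⟩
  · rw [hPd] at hw
    obtain ⟨v, hv, rfl⟩ := hw
    obtain ⟨hC, h0, h1⟩ := hRd v (hQd ▸ hv)
    simp only [Matrix.cons_val_zero, Matrix.cons_val_one]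
    exact ⟨hC, pow_pos h0 k, pow_lt_one₀ h0.le h1 (by omega)⟩
  · have e : (k : ℤ) • KZ.of R - KZ.of P = ((k : ℤ) • KZ.of R - KZ.of Q) + (KZ.of Q - KZ.of P) := by
      abel
    rw [e]
    exact KZ.relations.add_mem hQ hP

/-- **Slot B:** as slot A, followed by the inversion: `D' ⊆ {C(τ)} × (1, ∞)`. [cite: KontsevichZagier2001, §1.2] -/
theorem slotB (C : ℝ → Prop) (R : KZ.IntegralRep 2)
    (hRd : ∀ w ∈ R.domain, C (w 0) ∧ 0 < w 1 ∧ w 1 < 1) (hRi : EqOn R.integrand gInt R.domain)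
    (k : ℕ) (hk : 1 ≤ k) :
    ∃ P : KZ.IntegralRep 2, (∀ w ∈ P.domain, C (w 0) ∧ 1 < w 1) ∧
      EqOn P.integrand gInt P.domain ∧ (k : ℤ) • KZ.of R - KZ.of P ∈ KZ.relations := by
  obtain ⟨P, hPd, hPi, hP⟩ := slotA C R hRd hRi k hk
  obtain ⟨Q, hQd, hQi, hQ⟩ := invert_rep P hPi (fun w hw => (hPd w hw).2.1)
  refine ⟨Q, fun w hw => ?_, hQi, ?_⟩
  · rw [hQd] at hw
    obtain ⟨v, hv, rfl⟩ := hw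
    obtain ⟨hC, h0, h1⟩ := hPd v hv
    simp only [Matrix.cons_val_zero, Matrix.cons_val_one]
    exact ⟨hC, (one_lt_inv₀ h0).2 h1⟩
  · have e : (k : ℤ) • KZ.of R - KZ.of Q = ((k : ℤ) • KZ.of R - KZ.of P) + (KZ.of P - KZ.of Q) := by
      abel
    rw [e]
    exact KZ.relations.add_mem hP hQ

/-- Gluing two pieces with integrand `g` and disjoint domains (rule (1)). [cite: KontsevichZagier2001, §1.2 rule (1)] -/
theorem glue_rep (P Q : KZ.IntegralRep 2) (h : Disjoint P.domain Q.domain)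
    (hPi : EqOn P.integrand gInt P.domain) (hQi : EqOn Q.integrand gInt Q.domain) :
    ∃ S : KZ.IntegralRep 2, S.domain = P.domain ∪ Q.domain ∧ EqOn S.integrand gInt S.domain ∧
      KZ.of S - KZ.of P - KZ.of Q ∈ KZ.relations := by
  refine ⟨P.glue Q h, rfl, fun w hw => ?_,
    KZ.domainAddRel_subset_relations (KZ.IntegralRep.of_glue_sub_sub_mem_domainAddRel P Q h)⟩
  rcases hw with hw | hw
  · rw [KZ.IntegralRep.eqOn_integrand_glue_left P Q h hw, hPi hw]
  · rw [KZ.IntegralRep.eqOn_integrand_glue_right P Q h hw, hQi hw]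

/-! ### The unit-circle pieces and their `τ`-windows -/

end Pair
end Summit.KontsevichZagierPeriods.RootDecompQuadraticDescent.Z7Compose
end
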